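import Literature.Analysis.FluidPDE.NSCriticalClosure
import Literature.Analysis.FluidPDE.NSCriticalClosureTao
import Literature.Analysis.FluidPDE.CriticalRegularityProofs
import Literature.Analysis.FluidPDE.GKPCriticalElements
import Literature.Analysis.FluidPDE.TaoLocalisation
import Literature.Analysis.FluidPDE.TaoLocalisationProofs
import Literature.Analysis.FluidPDE.TaoH1Mild
import Literature.Analysis.FluidPDE.ClassicalSolutionGlue
import HarnessLib

/-!
# The critical Besov continuation criterion — assembly of `NS.hasSmoothExtensionPast_of_eHomBesovNorm_bounded`

`Literature.Analysis.FluidPDE.NSCriticalClosure` records the named fact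
`Literature.Analysis.FluidPDE.hasSmoothExtensionPast_of_eHomBesovNorm_bounded` (route `MonotoneCritical`, crux #5,
"Besov shape"): a classical solution of the unforced Navier–Stokes system on `ℝ³ × [0, T)` which
is a Leray–Hopf solution from its rapidly decaying datum, whose slices have tempered
distributions `U t` with `sup_{0 ≤ t < T} ‖U t‖_{Ḃ^{-1+3/r}_{r,q}} < ∞` for some `3 < r, q < ∞`,
extends as a classical solution past `T`.

In print this is the contrapositive of **Gallagher–Koch–Planchon 2016, Thm. 1**
(arXiv:1407.4156, p. 5: "Let `p, q ∈ (3, ∞)` … `u = NS(u₀) ∈ 𝓛^{1:∞}_{p,q}[T < T*]` the unique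
strong Navier–Stokes solution with maximal time of existence `T*`. If `T* < ∞`, then
`limsup_{t → T*} ‖u(t)‖_{Ḃ^{s_p}_{p,q}} = ∞`"), vendored as the named fact `NS.gkp_besov_blowup`
(`CriticalRegularity.lean`; reduced to GKP's Props. 2.1–2.2 and the statement of Prop. 2.3 in
`GKPCriticalElements.lean`),
combined with the **identification of the classical solution with `NS(u₀)`** — GKP (1.6),
p. 4: for `u₀ ∈ Ḃ^{s_p}_{p,q}` two solutions of the Duhamel equation (1.2) in `𝓛^{1:∞}_{p,q}(T)`
coincide and lie in `C([0,T]; Ḃ^{s_p}_{p,q}) ∩ C^∞(ℝ³ × (0,T])`. This file **proves the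
assembly** from `NS.gkp_besov_blowup`, three Tao 2013 facts already in the tree, and three new
elementary-to-state named facts (two Littlewood–Paley embeddings and GKP (1.6)).

## The proof (contrapositive; GKP 2016 Thm. 1 with (1.6))

Let `(u, p)` be classical on `[0, T)`, Leray–Hopf from the rapidly decaying `u(0)`, with
distributions `U t` and `sup_{[0,T)} ‖U t‖_{Ḃ^{s_r}_{r,q}} < ∞`, and suppose `u` does not extend
past `T`.

1. `(u, U)` is a Besov mild solution on `[0, T)` in the class `(s_r, r, q)` of
   `CriticalRegularity.lean` (`isBesovMildSolutionOn_of_classical`). On every closed slab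
   `[0, T']`, `T' < T`, the energy is bounded (Leray–Hopf energy inequality), so by Tao 2013
   (Cor. 11.1 + Cor. 4.3 + Thm. 5.4; named facts `tao2011_hasBoundedSobolevNormsOn`,
   `tao2011_isMildNSSolutionOn_of_memSobolevX`, `tao2011_smooth_local_existence`)
   `u ∈ L^∞_t H^k_x` for all `k`, `u` is mild from `u(0)` in the tested Duhamel form, `u` is
   bounded (Sobolev imbedding, discharged fact `linfty_bound_of_hasBoundedSobolevNormsOn_holds`)
   — whence Kato's class — and `u ∈ C([0,T']; L²)` (`continuousInLpOn_two_of_tao_local`: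
   Tao's smooth local solutions from the restart data `u(t')` have a uniform lifespan and are
   `L²`-continuous, and coincide with `u(· + t')` by the *proved* weak–strong uniqueness
   theorem `serrin_weak_strong_uniqueness_holds`, as in `NSCriticalClosureTao.lean`).
   Continuity in `Ḃ^{s_r}_{r,q}` then follows from the multiplicative
   embedding `‖w‖_{Ḃ^{-1+3/r}_{r,q}} ≤ C ‖w‖₂^{1/2} ‖∇w‖₂^{1/2}` (`H¹ ⊂ Ḣ^{1/2} ⊂ Ḃ^{s_r}_{r,q}`,
   Bahouri–Chemin–Danchin Prop. 1.32, Lemma 2.1, Prop. 2.20; new named fact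
   `eHomBesovNorm_le_of_sobolev_one`) applied to `w = u(t) - u(t₀)` with the uniform bound on
   `‖∇u‖₂`, and the realisation condition `Ṡ_j U t → 0` from `u(t) ∈ L²` (BCD Def. 1.26; new
   named fact `tendsto_lowFreqCutoff_of_memLp_two`).
2. By GKP Thm. 1 in `sup` form (`gkp_besov_blowup.not_isMaximalBesovMildSolution_of_biSup_lt_top`,
   `CriticalRegularityProofs.lean`) the bounded critical norm forces `(u, U)` **not** to be
   maximal with lifespan `T`: some Besov mild solution `(v, V)` on a longer `[0, T')` agrees
   with `u` a.e. at every time of `[0, T)`.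
3. By GKP (1.6) (`NS(u₀) ∈ C^∞(ℝ³ × (0,T])`; named fact `gkp_smooth_of_isBesovMildSolutionOn`,
   with Lemarié-Rieusset 2016 Thm. 9.12 for the class-level statement — **deprecated, mis-stated
   over the tree's class, 2026-08-16**: §Verdict clean-up below; the corrected bounded form is
   `knss_classical_of_bounded_isBesovMildSolutionOn`, proved) `v` agrees a.e. with a
   classical solution `(u', p')` on `(0, T')`; continuous slices a.e. equal are equal, so
   `u' = u` on `(0, T)`, and gluing `(u, p)` on `[0, T)` with `(u', p')` on `(0, T')`
   (`IsClassicalNSSolutionOn.glue`, `ClassicalSolutionGlue.lean`) extends `u` past `T` —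
   contradiction (`hasSmoothExtensionPast_of_isBesovMildSolutionOn_extension`).

## Contents

* named facts (D-0014, `def … : Prop`, nothing asserted):
  `NS.tendsto_lowFreqCutoff_of_memLp_two` (BCD Def. 1.26 with the Examples p. 22),
  `NS.eHomBesovNorm_le_of_sobolev_one` (BCD Prop. 1.32 + Lemma 2.1 + Prop. 2.20) — both since
  discharged (`tendsto_lowFreqCutoff_of_memLp_two_holds`, `eHomBesovNorm_le_of_sobolev_one_holds`,
  `NSCriticalClosureBesovProofs.lean`) —, and
  `NS.gkp_smooth_of_isBesovMildSolutionOn` (GKP 2016, (1.6)) — **deprecated (mis-stated) since the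
  verdict clean-up of 2026-08-16**, statement kept verbatim for its users; see §Verdict clean-up
  below for what is wrong with it and for the corrected (proved) statements
  `knss_classical_of_bounded_isBesovMildSolutionOn` (`NSCriticalClosureBesovBounded.lean`) and
  `IsKatoBesovMildSolutionOn.exists_classical` (`AlbrittonKatoClassIntegralForm.lean`);
* proved: `NS.IsDistributionOf.sub`, `NS.continuousInLpOn_two_of_tao_local`,
  `NS.continuousInHomBesovOn_closedSlab`, `NS.isBesovMildSolutionOn_of_classical`,
  `NS.hasSmoothExtensionPast_of_isBesovMildSolutionOn_extension`,
  `NS.hasSmoothExtensionPast_of_eHomBesovNorm_bounded_of_gkp` (the assembly from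
  `gkp_besov_blowup`, the three Tao facts and the three new facts). A former record,
  `NS.hasSmoothExtensionPast_of_eHomBesovNorm_bounded_of_criticalElements` — the same assembly with
  GKP Thm. 1 opened up into GKP §2.1: from (1.1), (1.9), Props. 2.1, 2.2 and 2.3 via
  `gkp_besov_blowup_of_criticalElements` — was dropped when the tree-class rendering
  `gkp_rigidity` of Prop. 2.3 was merged back into the proof obligation of Thm. 1 on review
  (2026-08-15, D-0026: mis-stated over the tree's class, Step 3 of the printed proof by
  contradiction, and a corollary of `gkp_besov_blowup` itself, `gkp_rigidity_of_gkp_besov_blowup`):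
  Prop. 2.3 is no longer a named fact of the tree, so that record was no longer one on named
  facts; it is a one-line composition of `hasSmoothExtensionPast_of_eHomBesovNorm_bounded_of_gkp`
  with `gkp_besov_blowup_of_criticalElements`, which keeps the statement of Prop. 2.3 as an
  explicit hypothesis.

## Status of the assembly's inputs (2026-08-16)

`hasSmoothExtensionPast_of_eHomBesovNorm_bounded_holds` is **proved** in the tree
(`NSCriticalClosureBesovHolds.lean`, by the blow-up/rigidity route of Wang–Zhang 2017, §4 through
`hasSmoothExtensionPast_of_eHomBesovNorm_bounded_of_classical_regular`), independently of this
file. Along the assembly of *this* file: the three Tao 2013 facts are discharged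
(`tao2011_hasBoundedSobolevNormsOn_holds`, `TaoLocalisationHolds.lean`;
`tao2011_isMildNSSolutionOn_of_memSobolevX_holds`, `TaoH1MildProofs.lean`;
`tao2011_smooth_local_existence_holds`, `CheskidovShvydkoyRegularProofs.lean`), the two
Littlewood–Paley facts are discharged (`NSCriticalClosureBesovProofs.lean`), and the two GKP
renderings `gkp_besov_blowup` (Thm. 1; `CriticalRegularity.lean`, 2026-08-15) and
`gkp_smooth_of_isBesovMildSolutionOn` ((1.6); this file, 2026-08-16) are **deprecated, mis-stated
over the tree's class** — the assembly `hasSmoothExtensionPast_of_eHomBesovNorm_bounded_of_gkp`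
stays a correct implication between the `Prop`s it names, kept verbatim as a record. Its
re-routing through the corrected smoothing statement is
`hasSmoothExtensionPast_of_eHomBesovNorm_bounded_of_gkp_knss` (`NSCriticalClosureBesovBounded.lean`).

## Verdict clean-up (2026-08-16): `gkp_smooth_of_isBesovMildSolutionOn` is mis-stated

**What is printed.** GKP 2016, p. 4 (CMP (1.6) = arXiv (1.7)): for a fixed `p`, `q` with
`3 < p < ∞`, `1 ≤ q < ∞`: "`u₀ ∈ Ḃ^{s_p}_{p,q}`, `T > 0`, `u₁, u₂` satisfy (1.2) in
`𝓛^{1:∞}_{p,q}(T)` `⟹` `u₁ = u₂ ∈ C([0,T]; Ḃ^{s_p}_{p,q}) ∩ C^∞(ℝ³ × (0,T])`", where (1.2) is the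
Duhamel equation `u(t) = e^{tΔ}u₀ + B(u,u)(t)` and `𝓛^{1:∞}_{p,q}(T) =
L̃¹([0,T]; Ḃ^{s_p+2}_{p,q}) ∩ L̃^∞([0,T]; Ḃ^{s_p}_{p,q})` is the Chemin–Lerner path space of
Def. 1.2 / (1.5), in which `NS(u₀)` is constructed by fixed point and the bilinear term converges
absolutely (the heat, paraproduct and Bernstein estimates of the paper's second appendix).

**What was vendored, and what is wrong with it.** `gkp_smooth_of_isBesovMildSolutionOn`
quantifies over *every* member `(u, U)` of the tree's class `IsBesovMildSolutionOn (-1+3/p) p q T ν`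
(`CriticalRegularity.lean`): the duality-form mild identity **from `t = 0`**
(`Fluid.IsMildNSSolutionOn (Ico 0 T) ν 0 (u 0) u`, Mathlib Bochner integrals, junk value `0`),
`U ∈ C([0,T); Ḃ^{s_p}_{p,q})`, and Kato's class `K_∞` (`sup_{0<τ<t} √τ ‖u(τ)‖_∞ < ∞`, `→ 0` at
`0⁺`) — with neither `𝓛^{1:∞}_{p,q}` nor `K_p` control. On this class the nonlinear integrand
`τ ↦ ∫ ⟪u τ, (u τ · ∇) e^{ν(t-τ)Δ}φ⟫` of the identity is a priori only `O(τ⁻¹)` as `τ → 0⁺`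
(`K_∞` and `C_t Ḃ^{s_p}_{p,q}`, `s_p < 0`, give no better), so the time integral may be the junk
value `0` and the identity need not determine `u` near `t = 0`; the docstring of
`Fluid.IsMildNSSolutionBetween` asks for precisely the integrability class that GKP's and
Albritton's classes supply (`𝓛^{1:∞}_{p,q}`, resp. `K̊_p ∩ K̊_∞` of Albritton 2018, Thm. 4.2
(4.52), where Hölder with `‖u(τ)‖_p ≤ C τ^{s_p/2}` gives `O(τ^{-1+3/(2p)}) ∈ L¹(0,t)`) and the
tree's does not, and this class is not a published uniqueness class (`CriticalRegularity.lean`,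
§Verdict clean-up, with its sources: Fujii 2026, Thm. 1.2; Miura 2005, Thm. 2.3). No
printed argument covers the junk regime (Lemarié-Rieusset 2016, Thm. 9.12, the class-level source
named by the fact, is printed for *bounded* solutions of the Oseen integral equation). The
machine-checked dissection is `gkp_smooth_of_isBesovMildSolutionOn_of_knss_of_restart`
(`NSCriticalClosureBesovTranslate.lean`): this `Prop` = the bounded smoothing theorem + the
restart of the duality identity at positive times for the tree's class, the latter unprinted and
not asserted anywhere. So the fact is **stated stronger than its source** and cannot be discharged
as stated (verdict of its prove seat, re-verified here against arXiv:1407.4156 pp. 3–4 and the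
definitions of `MildSolution.lean` / `CriticalRegularity.lean`); nothing asserts that it is false.

**Disposition (restate).** The `def` is **deprecated** and kept verbatim, statement unchanged,
because `hasSmoothExtensionPast_of_isBesovMildSolutionOn_extension`,
`hasSmoothExtensionPast_of_eHomBesovNorm_bounded_of_gkp` (this file),
`knss_classical_of_bounded_isBesovMildSolutionOn_of_gkp_smooth` (`NSCriticalClosureBesovBounded.lean`)
and `gkp_smooth_of_isBesovMildSolutionOn_of_knss_of_restart`,
`gkp_smooth_of_isBesovMildSolutionOn_of_local_of_restart` (`NSCriticalClosureBesovTranslate.lean`)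
take it as a hypothesis or a conclusion (each under `set_option linter.deprecated false`). The
**corrected statements are already declared and proved in the tree** (downstream of this file,
whence the string form of the deprecation):

* for its users — the continuation criterion only ever applies the fact to Besov mild extensions
  of a classical solution, which are essentially bounded down to `t = 0` — the named fact
  `knss_classical_of_bounded_isBesovMildSolutionOn` (`NSCriticalClosureBesovBounded.lean`: the same
  binders plus `∀ T₁ ∈ Ioo 0 T, ∃ C < ∞, ∀ t ∈ Ioo 0 T₁, ‖u t‖_{L^∞} ≤ C`, under which every
  integral of the identity converges absolutely; Koch–Nadirashvili–Seregin–Šverák 2009, §4 with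
  Lemma 3.1, Rem. 3.1, Prop. 4.1 — the class-level content of (1.6)), **proved**:
  `knss_classical_of_bounded_isBesovMildSolutionOn_holds` (`KNSSSmoothingHolds.lean`);
* (1.6) for `NS(u₀)` itself, read over Albritton's uniqueness class
  `K̊_p ∩ K̊_∞ ∩ C((0,T); L^p ∩ L^∞)` of that solution (Albritton 2018, Thm. 4.2 (4.52); tree:
  `IsKatoBesovMildSolutionOn`, `AlbrittonBlowupCriterionKato.lean`), the **proved** theorem
  `IsKatoBesovMildSolutionOn.exists_classical` (`AlbrittonKatoClassIntegralForm.lean`: for every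
  `t₀ ∈ (0, T)` a classical solution on `(t₀, T)` a.e. equal to `u`).

The literal path-space reading — over `IsGKPSolutionOn p q T ν u U` of `GKPCriticalElements.lean`
(the tree's class plus `U ∈ 𝓛^{1:∞}_{p,q}[T' < T]`), with the conclusion of the deprecated `Prop` —
has no user in the tree and is not declared by this clean-up (D-0026: a verdict clean-up adds no
unproved named fact).

## References

* I. Gallagher, G. S. Koch, F. Planchon, *Blow-up of critical Besov norms at a potential
  Navier–Stokes singularity*, Comm. Math. Phys. 343 (2016) 39–82 = arXiv:1407.4156: (1.2),
  (1.6) (p. 4), Thm. 1 (p. 5), §2.1 (p. 6).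
* T. Tao, *Localisation and compactness properties of the Navier–Stokes global regularity
  problem*, Anal. PDE 6 (2013) 25–107 = arXiv:1108.1165: Thm. 5.4 (i), (ii), (iv) (arXiv
  Thm. 31, p. 18), Cor. 4.3, Cor. 11.1.
* G. Prodi (1959), J. Serrin (1963): weak–strong uniqueness (proved in the tree:
  `NS.serrin_weak_strong_uniqueness_holds`, `NSSerrinUniqueness.lean`).
* H. Bahouri, J.-Y. Chemin, R. Danchin, *Fourier Analysis and Nonlinear PDE*, Grundlehren 343
  (2011): Def. 1.26 and Examples (p. 22), Prop. 1.32 (p. 25), Lemma 2.1, Def. 2.15, Prop. 2.20.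
* P. G. Lemarié-Rieusset, *The Navier–Stokes Problem in the 21st Century* (2016), Thm. 9.12
  (analyticity of bounded mild solutions).
* G. Koch, N. Nadirashvili, G. Seregin, V. Šverák, *Liouville theorems for the Navier–Stokes
  equations and applications*, Acta Math. 203 (2009) 83–105 = arXiv:0709.3599, §4 with Lemma 3.1,
  Rem. 3.1, Prop. 4.1 (regularity of bounded solutions; the source of the corrected statement
  `knss_classical_of_bounded_isBesovMildSolutionOn`).
* D. Albritton, *Blow-up criteria for the Navier–Stokes equations in non-endpoint critical Besov
  spaces*, Anal. PDE 11 (2018) 1415–1456 = arXiv:1612.04439, Thm. 4.2 with (4.52) (the uniqueness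
  class `K̊_p ∩ K̊_∞ ∩ C((0,T]; L^p ∩ L^∞)` of `NS(u₀)`; tree: `IsKatoBesovMildSolutionOn`).
-/

noncomputable section

open MeasureTheory TemperedDistribution Set Function Filter Topology
open scoped SchwartzMap ENNReal NNReal

namespace Literature.Analysis.FluidPDE

/-- Local notation for physical space `ℝ³ = EuclideanSpace ℝ (Fin 3)`. -/
local notation "ℝ³" => EuclideanSpace ℝ (Fin 3)

/-- Local notation for the complexified target `ℂ³ = EuclideanSpace ℂ (Fin 3)`. -/
local notation "ℂ³" => EuclideanSpace ℂ (Fin 3)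

/-! ## The named facts -/

section Facts

/-- **`L²` functions have vanishing low frequencies** (Bahouri–Chemin–Danchin 2011, Def. 1.26
of `𝓢'_h` — "`lim_{λ → ∞} ‖θ(λD) u‖_{L^∞} = 0` for any `θ ∈ 𝓓`" — with the first of the Examples
following it, p. 22: "if a tempered distribution `u` is such that its Fourier transform is
locally integrable near `0`, then `u` belongs to `𝓢'_h`"). For `f ∈ L²(ℝ³; ℝ³)` the Fourier
transform is in `L² ⊂ L¹_loc`, so the distribution `W` of `f` satisfies `Ṡ_j W = χ(2^{-j}D) W → 0`
(even in `L^∞`, a fortiori in `𝓢'`) as `j → -∞`, i.e. the realisation condition of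
`Literature.Analysis.FunctionSpaces.MemHomBesov`. [cite: BahouriCheminDanchin2011, Def. 1.26 and Examples p. 22] -/
def tendsto_lowFreqCutoff_of_memLp_two : Prop :=
  ∀ ⦃f : ℝ³ → ℝ³⦄ ⦃W : 𝓢'(ℝ³, ℂ³)⦄, MemLp f 2 volume → IsDistributionOf f W →
    Tendsto (fun j : ℤ => FunctionSpaces.lowFreqCutoff j W) atBot (𝓝 0)

/-- **`H¹(ℝ³) ⊂ Ḃ^{-1+3/p}_{p,q}(ℝ³)`, multiplicatively** (Bahouri–Chemin–Danchin 2011: Bernstein's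
Lemma 2.1, the Besov embedding Prop. 2.20 and the interpolation Prop. 1.32). For `2 ≤ p < ∞`,
`2 ≤ q` there is `C` such that for every `C¹` field `f ∈ L²(ℝ³; ℝ³)` with tempered distribution
`W`,
`‖W‖_{Ḃ^{-1+3/p}_{p,q}} ≤ C ‖f‖_{L²}^{1/2} ‖∇f‖_{L²}^{1/2}`.
Chain in print: `Ḃ^{1/2}_{2,2} ↪ Ḃ^{1/2 - 3(1/2 - 1/p)}_{p,q} = Ḃ^{-1+3/p}_{p,q}` for `p ≥ 2`, `q ≥ 2`
(Prop. 2.20), `‖·‖_{Ḃ^{1/2}_{2,2}} ≤ C ‖·‖_{Ḣ^{1/2}}` (Def. 2.15 with Plancherel: the blocks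
`Δ̇_j` are almost orthogonal in `L²`), and `‖f‖_{Ḣ^{1/2}} ≤ ‖f‖_{L²}^{1/2} ‖f‖_{Ḣ¹}^{1/2}`
(Prop. 1.32 with `s₀ = 0`, `s₁ = 1`, `θ = 1/2`), `‖f‖_{Ḣ¹} = ‖∇f‖_{L²}`; equivalently, block by
block, `2^{j(-1+3/p)} ‖Δ̇_j f‖_{L^p} ≤ C 2^{j/2} ‖Δ̇_j f‖_{L²} ≤ C 2^{j/2} min(‖f‖₂, 2^{-j} ‖∇f‖₂)`
(Lemma 2.1 twice) and `∑_j 2^{j/2} min(A, 2^{-j} B) ≤ C √(AB)`. Stated for `C¹` representatives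
(so that `fderiv` is the weak gradient, no junk values), with Mathlib's `eLpNorm` and the
operator norm of the Fréchet derivative `fderiv ℝ f x` (equivalent to the Euclidean norm of
`∇f(x)` up to a dimensional constant absorbed in `C`); if `∇f ∉ L²` the right-hand side is `∞`.
[cite: BahouriCheminDanchin2011, Lemma 2.1 + Prop. 2.20 + Prop. 1.32] -/
def eHomBesovNorm_le_of_sobolev_one : Prop :=
  ∀ ⦃p q : ℝ≥0∞⦄ [Fact (1 ≤ p)], 2 ≤ p → p < ∞ → 2 ≤ q →
    ∃ C : ℝ≥0, ∀ ⦃f : ℝ³ → ℝ³⦄ ⦃W : 𝓢'(ℝ³, ℂ³)⦄, ContDiff ℝ 1 f → MemLp f 2 volume →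
      IsDistributionOf f W →
        FunctionSpaces.eHomBesovNorm (-1 + 3 / p.toReal) p q W ≤
          C * eLpNorm f 2 volume ^ (1 / 2 : ℝ) * eLpNorm (fderiv ℝ f) 2 volume ^ (1 / 2 : ℝ)

/-- **Deprecated (2026-08-16) — mis-stated** (verdict of its prove seat, re-verified against
arXiv:1407.4156, pp. 3–4, and the definitions of `MildSolution.lean` / `CriticalRegularity.lean`;
the statement is kept verbatim, unchanged, because `hasSmoothExtensionPast_of_isBesovMildSolutionOn_extension`,
`hasSmoothExtensionPast_of_eHomBesovNorm_bounded_of_gkp` (this file),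
`knss_classical_of_bounded_isBesovMildSolutionOn_of_gkp_smooth` (`NSCriticalClosureBesovBounded.lean`)
and `gkp_smooth_of_isBesovMildSolutionOn_of_knss_of_restart`,
`gkp_smooth_of_isBesovMildSolutionOn_of_local_of_restart` (`NSCriticalClosureBesovTranslate.lean`)
take it as a hypothesis or a conclusion). *Intended:* GKP 2016, (1.6) (CMP numbering; (1.7) of
arXiv:1407.4156, p. 4): for fixed `3 < p < ∞`, `1 ≤ q < ∞`, "`u₀ ∈ Ḃ^{s_p}_{p,q}`, `T > 0`, `u₁, u₂`
satisfy (1.2) in `𝓛^{1:∞}_{p,q}(T)` `⟹` `u₁ = u₂ ∈ C([0,T]; Ḃ^{s_p}_{p,q}) ∩ C^∞(ℝ³ × (0,T])`" —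
`NS(u₀)` is smooth at positive times (and, being a smooth mild solution, solves the differential
system (NS) of p. 3 with the associated pressure). *What is wrong:* in print the statement
concerns solutions of the Duhamel equation (1.2) in the Chemin–Lerner path space
`𝓛^{1:∞}_{p,q}(T) = L̃¹_T Ḃ^{s_p+2}_{p,q} ∩ L̃^∞_T Ḃ^{s_p}_{p,q}` (Def. 1.2, (1.5)), in which the
bilinear term converges absolutely; this `Prop` quantifies instead over every member of the tree's
class `IsBesovMildSolutionOn (-1+3/p) p q T ν u U` — the duality-form mild identity from `t = 0`
(`Fluid.IsMildNSSolutionOn`, Bochner integrals with junk value `0`), `U ∈ C([0,T); Ḃ^{s_p}_{p,q})`,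
Kato's class `K_∞` — which asks no path-space (nor `K_p`) control: there the nonlinear integrand
`τ ↦ ∫ ⟪u τ, (u τ · ∇) e^{ν(t-τ)Δ}φ⟫` is a priori only `O(τ⁻¹)` at `τ → 0⁺`, the time integral
may be junk, and no printed argument covers that regime (the class-level source named
originally, Lemarié-Rieusset 2016, Thm. 9.12, is printed for *bounded* solutions of the Oseen
integral equation). Machine-checked dissection: `gkp_smooth_of_isBesovMildSolutionOn_of_knss_of_restart`
(`NSCriticalClosureBesovTranslate.lean`) — this `Prop` = the bounded smoothing theorem + the
restart of the duality identity at positive times for the tree's class, the latter unprinted. The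
statement is thus stronger than its source; nothing asserts that it is false. *The corrected
statements (both proved in the tree, declared downstream of this file — see the module docstring,
§Verdict clean-up):* for its users, the named fact
`Literature.Analysis.FluidPDE.knss_classical_of_bounded_isBesovMildSolutionOn`
(`NSCriticalClosureBesovBounded.lean`: the same binders plus uniform essential boundedness of the
slices on every `(0, T₁)`, `T₁ < T`; Koch–Nadirashvili–Seregin–Šverák 2009, §4 with Lemma 3.1,
Rem. 3.1, Prop. 4.1), proved as `knss_classical_of_bounded_isBesovMildSolutionOn_holds`
(`KNSSSmoothingHolds.lean`); and, for `NS(u₀)` in Albritton's uniqueness class `K̊_p ∩ K̊_∞ ∩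
C((0,T); L^p ∩ L^∞)` (Albritton 2018, Thm. 4.2 (4.52); `IsKatoBesovMildSolutionOn`), the theorem
`Literature.Analysis.FluidPDE.IsKatoBesovMildSolutionOn.exists_classical`
(`AlbrittonKatoClassIntegralForm.lean`). *Original content (unchanged):* let `ν > 0`,
`3 < p < ∞`, `1 ≤ q < ∞`, `0 < T`, and let `(u, U)` be a Besov mild solution on `[0, T)` in the
class `(-1 + 3/p, p, q)` of `CriticalRegularity.lean`; then there is a classical solution `(v, π)`
of the unforced system on the open time interval `(0, T)` with `u(t) = v(t)` a.e. for every
`t ∈ (0, T)`. [cite: GKP2016, (1.6)] -/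
@[deprecated "mis-stated (2026-08-16): GKP 2016 (1.6) concerns solutions of the Duhamel equation (1.2) in the path space 𝓛^{1:∞}_{p,q}(T), where the bilinear term converges absolutely, but this Prop quantifies over the tree's class IsBesovMildSolutionOn (duality-form mild from t = 0 with junk-valued Bochner integrals, C_t Ḃ^{s_p}_{p,q}, K_∞ only), on which the nonlinear integrand is a priori only O(τ⁻¹) at τ → 0⁺; it is the bounded smoothing theorem + the unprinted restart property of that class (gkp_smooth_of_isBesovMildSolutionOn_of_knss_of_restart, NSCriticalClosureBesovTranslate.lean). Use Literature.Analysis.FluidPDE.knss_classical_of_bounded_isBesovMildSolutionOn (slices essentially bounded on every (0,T₁), T₁ < T; proved: knss_classical_of_bounded_isBesovMildSolutionOn_holds, KNSSSmoothingHolds.lean), or, for NS(u₀) in Albritton's class, Literature.Analysis.FluidPDE.IsKatoBesovMildSolutionOn.exists_classical (AlbrittonKatoClassIntegralForm.lean)" (since := "2026-08-16")]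
def gkp_smooth_of_isBesovMildSolutionOn : Prop :=
  ∀ ⦃ν T : ℝ⦄, 0 < ν → 0 < T → ∀ ⦃p q : ℝ≥0∞⦄ [Fact (1 ≤ p)], 3 < p → p < ∞ → 1 ≤ q → q < ∞ →
    ∀ ⦃u : ℝ → ℝ³ → ℝ³⦄ ⦃U : ℝ → 𝓢'(ℝ³, ℂ³)⦄,
      IsBesovMildSolutionOn (-1 + 3 / p.toReal) p q T ν u U →
        ∃ (v : ℝ → ℝ³ → ℝ³) (π : ℝ → ℝ³ → ℝ),
          FluidPDE.IsClassicalNSSolutionOn (Ioo 0 T) ν 0 v π ∧ ∀ t ∈ Ioo 0 T, u t =ᵐ[volume] v t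

end Facts

/-! ## Glue -/

section Glue

/-- The distribution of a difference of fields is the difference of their distributions
(`IsDistributionOf` is additive: the pairing `∫ φ • u` is linear in `u`). [folklore] -/
theorem IsDistributionOf.sub {ι : Type*} [Fintype ι] {E : Type*} [NormedAddCommGroup E]
    [NormedSpace ℝ E] [MeasureSpace E] {u v : E → EuclideanSpace ℝ ι}
    {U V : 𝓢'(E, EuclideanSpace ℂ ι)} (hU : IsDistributionOf u U) (hV : IsDistributionOf v V) :
    IsDistributionOf (u - v) (U - V) := by
  intro φ
  have hφ : (fun x => φ x • FunctionSpaces.EuclideanSpace.complexify ((u - v) x)) =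
      fun x => φ x • FunctionSpaces.EuclideanSpace.complexify (u x) - φ x • FunctionSpaces.EuclideanSpace.complexify (v x) := by
    funext x
    simp only [Pi.sub_apply, map_sub, smul_sub]
  rw [hφ]
  refine ⟨(hU φ).1.sub (hV φ).1, ?_⟩
  rw [integral_sub (hU φ).1 (hV φ).1, ← (hU φ).2, ← (hV φ).2]
  rfl

/-- `‖D(u t)‖_{L²} ≤ B^{1/2}` from the `n = 1` Sobolev bound `∫ ‖D¹(u t)‖² ≤ B`
(`‖iteratedFDeriv ℝ 1 f x‖ = ‖fderiv ℝ f x‖`). [folklore] -/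
theorem eLpNorm_fderiv_two_le_of_lintegral_iteratedFDeriv_one_le {f : ℝ³ → ℝ³} {B : ℝ≥0∞}
    (h : ∫⁻ x, ‖iteratedFDeriv ℝ 1 f x‖ₑ ^ 2 ≤ B) :
    eLpNorm (fderiv ℝ f) 2 volume ≤ B ^ (1 / 2 : ℝ) := by
  refine eLpNorm_two_le_rpow_of_lintegral_sq_le (le_of_eq_of_le (lintegral_congr fun x => ?_) h)
  have hx : ‖fderiv ℝ f x‖ = ‖iteratedFDeriv ℝ 1 f x‖ := by
    rw [← norm_iteratedFDeriv_fderiv (n := 0), norm_iteratedFDeriv_zero]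
  rw [← ofReal_norm, ← ofReal_norm, hx]

end Glue

/-! ## Step 1: the classical solution is a Besov mild solution -/

section Identification

variable {ν T : ℝ} {u : ℝ → ℝ³ → ℝ³} {p : ℝ → ℝ³ → ℝ} {U : ℝ → 𝓢'(ℝ³, ℂ³)}

/-- **`u ∈ C([0, T']; L²)` on closed sub-slabs, from Tao's smooth `H¹` local theory and
weak–strong uniqueness** (Tao 2013, Thm. 5.4 (i)–(ii), (iv): the `H¹` mild solution is a strong
solution, `u ∈ C⁰_t H¹_x ⊂ C⁰_t L²_x`; here *derived* for the given classical Leray–Hopf solution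
from the named facts `tao2011_smooth_local_existence` (Thm. 5.4 (ii)+(iv) with (i)) and
`tao2011_hasBoundedSobolevNormsOn` (Cor. 11.1 + Cor. 4.3 + Thm. 5.4 (iv)) and the *proved*
weak–strong uniqueness theorem `serrin_weak_strong_uniqueness_holds`, exactly as in assembly 3 of
the `L³` criterion, `NSCriticalClosureTao.lean`). For `T' < T`: on the closed slab
`[0, (T'+T)/2]` all Sobolev norms of `u` are bounded (Tao), so the restart data `u(t')` have
`‖u(t')‖²_{H¹} ≤ A` uniformly and Tao's smooth solutions from them live on `[0, τ]` with one
`τ = c ν³/(A²+1)`, and are continuous into `L²`; at every energy-good restarting time `t'`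
(a.e., `IsLerayHopfOn.ae_isLerayHopfOn_translate`; and at `t' = 0`) such a solution *is*
`u(· + t')` (`eq_restart_of_serrin`). Every `t₀ ∈ [0, T']` lies within `τ/2` after a good time,
so `u` is `L²`-continuous at `t₀`. [cite: Tao2011, Thm. 5.4 (i)+(ii)+(iv)] -/
theorem continuousInLpOn_two_of_tao_local (hTao : tao2011_smooth_local_existence)
    (h₁ : tao2011_hasBoundedSobolevNormsOn) (hν : 0 < ν) (hT : 0 < T)
    (hsol : FluidPDE.IsClassicalNSSolutionOn (Ico 0 T) ν 0 u p)
    (hLH : FluidPDE.IsLerayHopfOn T ν 0 (u 0) u) (h₀ : HasRapidSpatialDecay (u 0)) :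
    ∀ T' ∈ Ioo 0 T, FluidPDE.ContinuousInLpOn (Icc 0 T') 2 u := by
  intro T' hT'
  obtain ⟨c, hc, hloc⟩ := hTao
  -- a closed slab `[0, T₂]`, `T' < T₂ < T`, and the Sobolev bounds on it
  obtain ⟨T₂, hT₂I, hT'T₂⟩ : ∃ T₂ ∈ Ioo 0 T, T' < T₂ :=
    ⟨(T' + T) / 2, ⟨by linarith [hT'.1, hT'.2], by linarith [hT'.2]⟩, by linarith [hT'.2]⟩
  have hsol₂ : FluidPDE.IsClassicalNSSolutionOn (Icc 0 T₂) ν 0 u p :=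
    hsol.mono (Icc_subset_Ico_right hT₂I.2) (uniqueDiffOn_Icc hT₂I.1)
  have hEn₂ : ∃ C : ℝ≥0∞, C < ⊤ ∧ ∀ t ∈ Icc 0 T₂, ∫⁻ x, ‖u t x‖ₑ ^ 2 ≤ C :=
    ⟨ENNReal.ofReal (2 * VectorCalculus.kineticEnergy (u 0)), ENNReal.ofReal_lt_top, fun t ht =>
      hLH.lintegral_enorm_sq_le hν.le ⟨ht.1, ht.2.trans hT₂I.2.le⟩⟩
  have hH : HasBoundedSobolevNormsOn (Icc 0 T₂) u :=
    (tao2011_hasBoundedSobolevNormsOn.closedSlab h₁ linfty_bound_of_hasBoundedSobolevNormsOn_holds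
      ν T₂ hν hT₂I.1 u p hsol₂ hEn₂ h₀).1
  obtain ⟨C₀, hC₀⟩ := hH 0
  obtain ⟨C₁, hC₁⟩ := hH 1
  -- the uniform `H¹` bound `A` of the restart data and Tao's uniform lifespan `τ`
  set A : ℝ := (C₀ : ℝ) + 3 * C₁ with hA
  have hA0 : 0 ≤ A := by positivity
  have hdat : ∀ t' ∈ Icc 0 T₂, (∫⁻ x, ‖u t' x‖ₑ ^ 2) +
      (∫⁻ x, ENNReal.ofReal (FluidPDE.frobeniusNormSq (fderiv ℝ (u t') x))) ≤ ENNReal.ofReal A := by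
    intro t' ht'
    have h0 : ∫⁻ x, ‖u t' x‖ₑ ^ 2 ≤ C₀ :=
      (le_of_eq (lintegral_congr fun x => by
        rw [← ofReal_norm, ← norm_iteratedFDeriv_zero (𝕜 := ℝ) (f := u t'), ofReal_norm])).trans
        (hC₀ t' ht')
    have h1 : ∫⁻ x, ENNReal.ofReal (FluidPDE.frobeniusNormSq (fderiv ℝ (u t') x)) ≤ 3 * C₁ :=
      calc ∫⁻ x, ENNReal.ofReal (FluidPDE.frobeniusNormSq (fderiv ℝ (u t') x))
          ≤ ∫⁻ x, 3 * ‖iteratedFDeriv ℝ 1 (u t') x‖ₑ ^ 2 := lintegral_mono fun x => by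
            rw [← ofReal_norm, norm_iteratedFDeriv_one, ofReal_norm]
            exact ofReal_frobeniusNormSq_le_three_mul_enorm_sq _
        _ = 3 * ∫⁻ x, ‖iteratedFDeriv ℝ 1 (u t') x‖ₑ ^ 2 := lintegral_const_mul' _ _ (by simp)
        _ ≤ 3 * C₁ := by gcongr; exact hC₁ t' ht'
    calc (∫⁻ x, ‖u t' x‖ₑ ^ 2) + (∫⁻ x, ENNReal.ofReal (FluidPDE.frobeniusNormSq (fderiv ℝ (u t') x)))
        ≤ (C₀ : ℝ≥0∞) + 3 * C₁ := add_le_add h0 h1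
      _ = ENNReal.ofReal A := by
          rw [hA, ENNReal.ofReal_add (by positivity) (by positivity), ENNReal.ofReal_coe_nnreal,
            ENNReal.ofReal_mul (by norm_num), ENNReal.ofReal_coe_nnreal, ENNReal.ofReal_ofNat]
  set τ : ℝ := c * ν ^ 3 / (A ^ 2 + 1) with hτ
  have hτpos : 0 < τ := by positivity
  have hτc : A ^ 2 * τ ≤ c * ν ^ 3 := by
    calc A ^ 2 * τ = c * ν ^ 3 * (A ^ 2 / (A ^ 2 + 1)) := by rw [hτ]; ring
      _ ≤ c * ν ^ 3 * 1 :=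
          mul_le_mul_of_nonneg_left (by rw [div_le_one (by positivity)]; linarith) (by positivity)
      _ = c * ν ^ 3 := mul_one _
  -- Tao's smooth solution on `[0, τ]` from the datum `u t'`, `t' ∈ [0, T₂]`
  have hpatch : ∀ t' ∈ Icc 0 T₂, ∃ (v : ℝ → ℝ³ → ℝ³) (q : ℝ → ℝ³ → ℝ),
      FluidPDE.IsClassicalNSSolutionOn (Icc 0 τ) ν 0 v q ∧ v 0 = u t' ∧
      HasBoundedSobolevNormsOn (Icc 0 τ) v ∧
      (∀ n : ℕ, ∃ C : ℝ≥0, ∀ t ∈ Icc 0 τ, ∫⁻ x, ‖iteratedFDeriv ℝ n (q t) x‖ₑ ^ 2 ≤ C) ∧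
      FluidPDE.ContinuousInLpOn (Icc 0 τ) 2 v := by
    intro t' ht'
    have hHinf : ∀ n : ℕ, ∫⁻ x, ‖iteratedFDeriv ℝ n (u t') x‖ₑ ^ 2 < ⊤ := fun n => by
      obtain ⟨C, hC⟩ := hH n
      exact (hC t' ht').trans_lt ENNReal.coe_lt_top
    obtain ⟨v, q, hv, hv0, hvb, -, hqb, hvc⟩ := hloc hν hτpos (hsol₂.contDiff_velocity ht')
      (hsol₂.divFree t' ht') hHinf hA0 (hdat t' ht') hτc
    exact ⟨v, q, hv, hv0, hvb, hqb, hvc⟩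
  refine ⟨fun t ht => hLH.memLp t ⟨ht.1, ht.2.trans hT'.2.le⟩, fun t₀ ht₀ => ?_⟩
  have ht₀T : t₀ < T := ht₀.2.trans_lt hT'.2
  -- a restarting time `t' ≤ t₀` less than `τ/2` before `t₀`: `t' = 0`, or an energy-good time
  obtain ⟨t', ht'0, ht'lt, ht₀t', hLHt⟩ : ∃ t', 0 ≤ t' ∧ (t' = 0 ∨ t' < t₀) ∧ t₀ < t' + τ / 2 ∧
      FluidPDE.IsLerayHopfOn (T - t') ν 0 (u t') (fun t => u (t + t')) := by
    rcases eq_or_lt_of_le ht₀.1 with h0 | h0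
    · refine ⟨0, le_rfl, Or.inl rfl, by rw [← h0]; linarith, ?_⟩
      simpa using hLH
    · have hae := hLH.ae_isLerayHopfOn_translate hsol hν.le
      have hlt : max 0 (t₀ - τ / 2) < t₀ := max_lt h0 (by linarith)
      have hsub : Ioo (max 0 (t₀ - τ / 2)) t₀ ⊆ Ioo 0 T := fun s hs =>
        ⟨(le_max_left _ _).trans_lt hs.1, hs.2.trans ht₀T⟩
      obtain ⟨s, hs, hLHs⟩ := exists_mem_Ioo_of_ae_restrict hlt
        (ae_restrict_of_ae_restrict_of_subset hsub hae)
      exact ⟨s, ((le_max_left _ _).trans_lt hs.1).le, Or.inr hs.2,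
        by linarith [(le_max_right _ _).trans_lt hs.1], hLHs⟩
  have ht't₀ : t' ≤ t₀ := by
    rcases ht'lt with h | h
    · rw [h]; exact ht₀.1
    · exact h.le
  have ht'T : t' < T := ht't₀.trans_lt ht₀T
  obtain ⟨v, q, hv, hv0, hvb, hqb, hvc⟩ := hpatch t' ⟨ht'0, ht't₀.trans (ht₀.2.trans hT'T₂.le)⟩
  have heq : ∀ t ∈ Ico 0 (min τ (T - t')), u (t + t') = v t :=
    eq_restart_of_serrin serrin_weak_strong_uniqueness_holds hν hτpos ht'0 ht'T hsol hLHt hv hv0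
      hvb hqb hvc
  -- near `t₀` within `[0, T']`: `t - t' ∈ [0, min(τ, T - t'))`, where `u t = v (t - t')`
  have hs₀I : t₀ - t' ∈ Ico 0 (min τ (T - t')) :=
    ⟨by linarith, lt_min (by linarith) (by linarith)⟩
  have hev : ∀ᶠ t in 𝓝[Icc 0 T'] t₀, t - t' ∈ Ico 0 (min τ (T - t')) := by
    have h1 : ∀ᶠ t in 𝓝[Icc 0 T'] t₀, t - t' < min τ (T - t') :=
      (((continuous_sub_right t').tendsto t₀).eventually (gt_mem_nhds hs₀I.2)).filter_mono
        nhdsWithin_le_nhds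
    have h2 : ∀ᶠ t in 𝓝[Icc 0 T'] t₀, 0 ≤ t - t' := by
      rcases ht'lt with h | h
      · filter_upwards [eventually_mem_nhdsWithin (a := t₀) (s := Icc 0 T')] with t ht
        rw [h, sub_zero]
        exact ht.1
      · filter_upwards [(lt_mem_nhds h).filter_mono (nhdsWithin_le_nhds (s := Icc 0 T'))]
          with t ht using by linarith
    exact (h2.and h1).mono fun t ht => ⟨ht.1, ht.2⟩
  have hcongr : ∀ᶠ t in 𝓝[Icc 0 T'] t₀,
      eLpNorm (v (t - t') - v (t₀ - t')) 2 volume = eLpNorm (u t - u t₀) 2 volume :=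
    hev.mono fun t ht => by rw [← heq _ ht, ← heq _ hs₀I, sub_add_cancel, sub_add_cancel]
  have hg : Tendsto (fun t => t - t') (𝓝[Icc 0 T'] t₀) (𝓝[Icc 0 τ] (t₀ - t')) :=
    tendsto_nhdsWithin_iff.2 ⟨((continuous_sub_right t').tendsto t₀).mono_left nhdsWithin_le_nhds,
      hev.mono fun t ht => ⟨ht.1, (ht.2.trans_le (min_le_left _ _)).le⟩⟩
  have hlim := (hvc.2 (t₀ - t') ⟨hs₀I.1, (hs₀I.2.trans_le (min_le_left _ _)).le⟩).comp hg
  exact hlim.congr' hcongr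

/-- **Continuity in `Ḃ^{-1+3/r}_{r,q}` on closed slabs** (GKP 2016, (1.6):
`NS(u₀) ∈ C([0,T]; Ḃ^{s_p}_{p,q})`, here derived for the classical solution). Given Tao's
regularity persistence (Cor. 11.1 + Cor. 4.3 + Thm. 5.4 (iv), named fact
`tao2011_hasBoundedSobolevNormsOn`) and the two Littlewood–Paley facts
(`tendsto_lowFreqCutoff_of_memLp_two`, `eHomBesovNorm_le_of_sobolev_one`): a classical unforced
solution on the closed slab `[0, T] × ℝ³` of finite energy with rapidly decaying datum, which is
continuous into `L²` and whose slices have distributions `U t`, satisfies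
`U ∈ C([0,T]; Ḃ^{-1+3/r}_{r,q})` for `2 ≤ r < ∞`, `2 ≤ q`. Proof: all Sobolev norms of `u` are
bounded on `[0, T]` (Tao), so `‖∇u(t)‖₂ ≤ B^{1/2}`; then
`‖U t - U t₀‖ ≤ C ‖u t - u t₀‖₂^{1/2} (2B^{1/2})^{1/2} → 0`, and each `U t` is in the space
(finite norm, realisation condition from `u t ∈ L²`). [cite: GKP2016, (1.6)] -/
theorem continuousInHomBesovOn_closedSlab (h₁ : tao2011_hasBoundedSobolevNormsOn)
    (hR : tendsto_lowFreqCutoff_of_memLp_two) (hE : eHomBesovNorm_le_of_sobolev_one)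
    (hν : 0 < ν) (hT : 0 < T) (hsol : FluidPDE.IsClassicalNSSolutionOn (Icc 0 T) ν 0 u p)
    (hEn : ∃ C : ℝ≥0∞, C < ⊤ ∧ ∀ t ∈ Icc 0 T, ∫⁻ x, ‖u t x‖ₑ ^ 2 ≤ C)
    (h₀ : HasRapidSpatialDecay (u 0)) (hL2 : FluidPDE.ContinuousInLpOn (Icc 0 T) 2 u)
    (hU : ∀ t ∈ Icc 0 T, IsDistributionOf (u t) (U t))
    {r q : ℝ≥0∞} [Fact (1 ≤ r)] (hr₂ : 2 ≤ r) (hr : r < ∞) (hq₂ : 2 ≤ q) :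
    ContinuousInHomBesovOn (Icc 0 T) (-1 + 3 / r.toReal) r q U := by
  -- Tao: all Sobolev norms bounded on the closed slab
  have hH : HasBoundedSobolevNormsOn (Icc 0 T) u :=
    (tao2011_hasBoundedSobolevNormsOn.closedSlab h₁ linfty_bound_of_hasBoundedSobolevNormsOn_holds
      ν T hν hT u p hsol hEn h₀).1
  obtain ⟨C, hC⟩ := hE hr₂ hr hq₂
  obtain ⟨B, hB⟩ := hH 1
  -- slices are `C¹`, in `L²`, with `‖∇u(t)‖₂ ≤ B^{1/2}`
  have hC1 : ∀ t ∈ Icc 0 T, ContDiff ℝ 1 (u t) := fun t ht =>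
    (hsol.contDiff_velocity ht).of_le (by norm_cast)
  have hL2mem : ∀ t ∈ Icc 0 T, MemLp (u t) 2 volume := hL2.1
  have hgrad : ∀ t ∈ Icc 0 T, eLpNorm (fderiv ℝ (u t)) 2 volume ≤ (B : ℝ≥0∞) ^ (1 / 2 : ℝ) :=
    fun t ht => eLpNorm_fderiv_two_le_of_lintegral_iteratedFDeriv_one_le (hB t ht)
  have hhalf : (0 : ℝ) ≤ 1 / 2 := by norm_num
  have hBtop : (B : ℝ≥0∞) ^ (1 / 2 : ℝ) ≠ ∞ :=
    ENNReal.rpow_ne_top_of_nonneg hhalf ENNReal.coe_ne_top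
  refine ⟨fun t ht => ⟨?_, hR (hL2mem t ht) (hU t ht)⟩, fun t₀ ht₀ => ?_⟩
  · -- finite norm
    refine (hC (hC1 t ht) (hL2mem t ht) (hU t ht)).trans_lt ?_
    refine ENNReal.mul_lt_top (ENNReal.mul_lt_top ENNReal.coe_lt_top ?_) ?_
    · exact ENNReal.rpow_lt_top_of_nonneg hhalf (hL2mem t ht).eLpNorm_ne_top
    · exact ENNReal.rpow_lt_top_of_nonneg hhalf (ne_top_of_le_ne_top hBtop (hgrad t ht))
  · -- continuity at `t₀`
    set K : ℝ≥0∞ := (C : ℝ≥0∞) * ((B : ℝ≥0∞) ^ (1 / 2 : ℝ) + (B : ℝ≥0∞) ^ (1 / 2 : ℝ)) ^ (1 / 2 : ℝ)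
      with hK
    have hKtop : K ≠ ∞ :=
      ENNReal.mul_ne_top ENNReal.coe_ne_top
        (ENNReal.rpow_ne_top_of_nonneg hhalf (ENNReal.add_ne_top.2 ⟨hBtop, hBtop⟩))
    have key : ∀ t ∈ Icc 0 T, FunctionSpaces.eHomBesovNorm (-1 + 3 / r.toReal) r q (U t - U t₀) ≤
        K * eLpNorm (u t - u t₀) 2 volume ^ (1 / 2 : ℝ) := by
      intro t ht
      have hdist : IsDistributionOf (u t - u t₀) (U t - U t₀) := (hU t ht).sub (hU t₀ ht₀)
      have h1 := hC ((hC1 t ht).sub (hC1 t₀ ht₀)) ((hL2mem t ht).sub (hL2mem t₀ ht₀)) hdist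
      -- `‖∇(u t - u t₀)‖₂ ≤ B^{1/2} + B^{1/2}`
      have hfd : fderiv ℝ (u t - u t₀) = fderiv ℝ (u t) - fderiv ℝ (u t₀) := by
        funext x
        exact fderiv_sub ((hC1 t ht).differentiable one_ne_zero x)
          ((hC1 t₀ ht₀).differentiable one_ne_zero x)
      have hmeas : ∀ s ∈ Icc 0 T, AEStronglyMeasurable (fderiv ℝ (u s)) volume := fun s hs =>
        ((hC1 s hs).continuous_fderiv one_ne_zero).aestronglyMeasurable
      have h2 : eLpNorm (fderiv ℝ (u t - u t₀)) 2 volume ≤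
          (B : ℝ≥0∞) ^ (1 / 2 : ℝ) + (B : ℝ≥0∞) ^ (1 / 2 : ℝ) := by
        rw [hfd]
        exact (eLpNorm_sub_le (hmeas t ht) (hmeas t₀ ht₀) one_le_two).trans
          (add_le_add (hgrad t ht) (hgrad t₀ ht₀))
      calc FunctionSpaces.eHomBesovNorm (-1 + 3 / r.toReal) r q (U t - U t₀)
          ≤ C * eLpNorm (u t - u t₀) 2 volume ^ (1 / 2 : ℝ) *
              eLpNorm (fderiv ℝ (u t - u t₀)) 2 volume ^ (1 / 2 : ℝ) := h1
        _ ≤ C * eLpNorm (u t - u t₀) 2 volume ^ (1 / 2 : ℝ) *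
              ((B : ℝ≥0∞) ^ (1 / 2 : ℝ) + (B : ℝ≥0∞) ^ (1 / 2 : ℝ)) ^ (1 / 2 : ℝ) := by
            gcongr
        _ = K * eLpNorm (u t - u t₀) 2 volume ^ (1 / 2 : ℝ) := by
            rw [hK]; ring
    have hlim : Tendsto (fun t => K * eLpNorm (u t - u t₀) 2 volume ^ (1 / 2 : ℝ))
        (𝓝[Icc 0 T] t₀) (𝓝 0) := by
      have h0 : Tendsto (fun t => eLpNorm (u t - u t₀) 2 volume ^ (1 / 2 : ℝ))
          (𝓝[Icc 0 T] t₀) (𝓝 0) := by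
        have := ((ENNReal.continuous_rpow_const (y := (1 / 2 : ℝ))).tendsto 0).comp (hL2.2 t₀ ht₀)
        rwa [ENNReal.zero_rpow_of_pos (by norm_num)] at this
      simpa only [mul_zero] using ENNReal.Tendsto.const_mul h0 (Or.inr hKtop)
    refine tendsto_of_tendsto_of_tendsto_of_le_of_le' tendsto_const_nhds hlim
      (Eventually.of_forall fun _ => zero_le) ?_
    exact (eventually_mem_nhdsWithin (a := t₀) (s := Icc 0 T)).mono key

/-- **The classical solution is `NS(u₀)`** (GKP 2016, (1.6) with Tao 2013, Cor. 11.1 + Cor. 4.3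
+ Thm. 5.4): given the named facts of `continuousInHomBesovOn_closedSlab`, a classical unforced
solution on `ℝ³ × [0, T)` which is Leray–Hopf from its rapidly decaying datum, with slices
represented by the distributions `U t`, is a Besov mild solution on `[0, T)` in the class
`(-1 + 3/r, r, q)` of `CriticalRegularity.lean`, `2 ≤ r < ∞`, `2 ≤ q`: on each closed slab
`[0, T']`, `T' < T`, the energy is bounded by the initial energy (Leray–Hopf), so `u` is mild
from `u(0)` (Cor. 4.3), bounded (Thm. 5.4 (iv) + Sobolev imbedding) — whence Kato's class
`sup_{0<τ<t} √τ ‖u(τ)‖_∞ ≤ √t · M < ∞`, `→ 0` as `t → 0⁺` —, continuous into `L²`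
(`continuousInLpOn_two_of_tao_local`, Thm. 5.4 (ii) + weak–strong uniqueness) and hence
continuous in `Ḃ^{-1+3/r}_{r,q}` (`continuousInHomBesovOn_closedSlab`); measurability on
`(0,T) × ℝ³` is joint continuity. [cite: GKP2016, (1.6)] -/
theorem isBesovMildSolutionOn_of_classical (h₁ : tao2011_hasBoundedSobolevNormsOn)
    (h₂ : tao2011_isMildNSSolutionOn_of_memSobolevX) (hTao : tao2011_smooth_local_existence)
    (hR : tendsto_lowFreqCutoff_of_memLp_two) (hE : eHomBesovNorm_le_of_sobolev_one)
    (hν : 0 < ν) (hT : 0 < T) (hsol : FluidPDE.IsClassicalNSSolutionOn (Ico 0 T) ν 0 u p)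
    (hLH : FluidPDE.IsLerayHopfOn T ν 0 (u 0) u) (h₀ : HasRapidSpatialDecay (u 0))
    (hU : ∀ t ∈ Ico 0 T, IsDistributionOf (u t) (U t))
    {r q : ℝ≥0∞} [Fact (1 ≤ r)] (hr₂ : 2 ≤ r) (hr : r < ∞) (hq₂ : 2 ≤ q) :
    IsBesovMildSolutionOn (-1 + 3 / r.toReal) r q T ν u U := by
  -- the closed-slab data: classical, finite energy, distributions
  have hslab : ∀ T' ∈ Ioo 0 T, FluidPDE.IsClassicalNSSolutionOn (Icc 0 T') ν 0 u p ∧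
      (∃ C : ℝ≥0∞, C < ⊤ ∧ ∀ t ∈ Icc 0 T', ∫⁻ x, ‖u t x‖ₑ ^ 2 ≤ C) ∧
      (∀ t ∈ Icc 0 T', IsDistributionOf (u t) (U t)) := fun T' hT' =>
    ⟨hsol.mono (Icc_subset_Ico_right hT'.2) (uniqueDiffOn_Icc hT'.1),
      ⟨ENNReal.ofReal (2 * VectorCalculus.kineticEnergy (u 0)), ENNReal.ofReal_lt_top, fun t ht =>
        hLH.lintegral_enorm_sq_le hν.le ⟨ht.1, ht.2.trans hT'.2.le⟩⟩,
      fun t ht => hU t ⟨ht.1, ht.2.trans_lt hT'.2⟩⟩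
  -- on each closed slab: mild from the datum, continuous in the Besov space, bounded
  have hmild : ∀ T' ∈ Ioo 0 T, FluidPDE.IsMildNSSolutionOn (Icc 0 T') ν 0 (u 0) u := by
    intro T' hT'
    obtain ⟨hsol', hEn', -⟩ := hslab T' hT'
    have hH : HasBoundedSobolevNormsOn (Icc 0 T') u :=
      (tao2011_hasBoundedSobolevNormsOn.closedSlab h₁
        linfty_bound_of_hasBoundedSobolevNormsOn_holds ν T' hν hT'.1 u p hsol' hEn' h₀).1
    exact h₂ hν hT'.1 hsol' (hH.memSobolevX 1)
  have hcont : ∀ T' ∈ Ioo 0 T, ContinuousInHomBesovOn (Icc 0 T') (-1 + 3 / r.toReal) r q U := by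
    intro T' hT'
    obtain ⟨hsol', hEn', hU'⟩ := hslab T' hT'
    exact continuousInHomBesovOn_closedSlab h₁ hR hE hν hT'.1 hsol' hEn' h₀
      (continuousInLpOn_two_of_tao_local hTao h₁ hν hT hsol hLH h₀ T' hT') hU' hr₂ hr hq₂
  have hbdd : ∀ T' ∈ Ioo 0 T, ∃ M : ℝ, ∀ t ∈ Icc 0 T', ∀ x, ‖u t x‖ ≤ M := by
    intro T' hT'
    obtain ⟨hsol', hEn', -⟩ := hslab T' hT'
    have hH : HasBoundedSobolevNormsOn (Icc 0 T') u :=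
      (tao2011_hasBoundedSobolevNormsOn.closedSlab h₁
        linfty_bound_of_hasBoundedSobolevNormsOn_holds ν T' hν hT'.1 u p hsol' hEn' h₀).1
    exact linfty_bound_of_hasBoundedSobolevNormsOn_holds
      (fun t ht => (hsol'.contDiff_velocity ht).of_le (by norm_cast)) hH
  -- every `t ∈ [0, T)` lies in a closed slab `[0, T']`, `T' = (t + T)/2 < T`
  have hmid : ∀ t ∈ Ico 0 T, (t + T) / 2 ∈ Ioo 0 T ∧ t < (t + T) / 2 := fun t ht =>
    ⟨⟨by linarith [ht.1, ht.2], by linarith [ht.2]⟩, by linarith [ht.2]⟩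
  -- slice bound in Kato's weighted form
  have hkato : ∀ T' ∈ Ioo 0 T, ∃ M : ℝ, ∀ τ ∈ Ioo 0 T',
      ENNReal.ofReal (Real.sqrt τ) * eLpNorm (u τ) ∞ volume ≤
        ENNReal.ofReal (Real.sqrt T') * ENNReal.ofReal M := by
    intro T' hT'
    obtain ⟨M, hM⟩ := hbdd T' hT'
    refine ⟨M, fun τ hτ => ?_⟩
    have h1 : eLpNorm (u τ) ∞ volume ≤ ENNReal.ofReal M := by
      rw [eLpNorm_exponent_top]
      exact eLpNormEssSup_le_of_ae_bound (Eventually.of_forall (hM τ ⟨hτ.1.le, hτ.2.le⟩))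
    have h2 : ENNReal.ofReal (Real.sqrt τ) ≤ ENNReal.ofReal (Real.sqrt T') :=
      ENNReal.ofReal_le_ofReal (Real.sqrt_le_sqrt hτ.2.le)
    exact mul_le_mul' h2 h1
  refine ⟨⟨fun t ht => ?_, fun t ht => ?_⟩, ?_, hU, ⟨fun t ht => ?_, fun t₀ ht₀ => ?_⟩,
    ⟨fun t htT => ?_, ?_⟩⟩
  · -- weakly divergence free
    obtain ⟨hT', htT'⟩ := hmid t ht
    exact (hmild _ hT').1 t ⟨ht.1, htT'.le⟩
  · -- Duhamel identity from the datum
    obtain ⟨hT', htT'⟩ := hmid t ht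
    exact (hmild _ hT').2 t ⟨ht.1, htT'.le⟩
  · -- measurability on `(0, T) × ℝ³`
    exact (hsol.smooth_velocity.continuousOn.mono
      (prod_mono Ioo_subset_Ico_self Subset.rfl)).aestronglyMeasurable
      (measurableSet_Ioo.prod MeasurableSet.univ)
  · -- `U t ∈ Ḃ^{s_r}_{r,q}`
    obtain ⟨hT', htT'⟩ := hmid t ht
    exact (hcont _ hT').1 t ⟨ht.1, htT'.le⟩
  · -- continuity at `t₀` within `[0, T)`: near `t₀` the sets `[0, T)` and `[0, T']` agree
    obtain ⟨hT', htT'⟩ := hmid t₀ ht₀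
    refine ((hcont _ hT').2 t₀ ⟨ht₀.1, htT'.le⟩).mono_left ?_
    calc 𝓝[Ico 0 T] t₀ = 𝓝[Ico 0 T ∩ Iio ((t₀ + T) / 2)] t₀ :=
          nhdsWithin_restrict' _ (Iio_mem_nhds htT')
      _ ≤ 𝓝[Icc 0 ((t₀ + T) / 2)] t₀ := nhdsWithin_mono _ fun t ht => ⟨ht.1.1, le_of_lt ht.2⟩
  · -- Kato's class: `sup_{0<τ<t} √τ ‖u(τ)‖_∞ < ∞` for `t < T`
    rcases le_or_gt t 0 with ht0 | ht0
    · rw [Ioo_eq_empty (not_lt.2 ht0)]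
      simp
    · obtain ⟨M, hM⟩ := hkato t ⟨ht0, htT⟩
      exact lt_of_le_of_lt (iSup₂_le hM) (ENNReal.mul_lt_top ENNReal.ofReal_lt_top
        ENNReal.ofReal_lt_top)
  · -- Kato's class: `√t ‖u(t)‖_∞ → 0` as `t → 0⁺`
    have hT2 : T / 2 ∈ Ioo 0 T := ⟨half_pos hT, half_lt_self hT⟩
    obtain ⟨M, hM⟩ := hbdd (T / 2) hT2
    have hslice : ∀ t ∈ Ioo 0 (T / 2), ENNReal.ofReal (Real.sqrt t) * eLpNorm (u t) ∞ volume ≤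
        ENNReal.ofReal (Real.sqrt t) * ENNReal.ofReal M := by
      intro t ht
      refine mul_le_mul' le_rfl ?_
      rw [eLpNorm_exponent_top]
      exact eLpNormEssSup_le_of_ae_bound (Eventually.of_forall (hM t ⟨ht.1.le, ht.2.le⟩))
    have hsqrt : Tendsto (fun t : ℝ => ENNReal.ofReal (Real.sqrt t)) (𝓝[>] 0) (𝓝 0) := by
      have hc : Continuous fun t : ℝ => ENNReal.ofReal (Real.sqrt t) :=
        ENNReal.continuous_ofReal.comp Real.continuous_sqrt
      have := (hc.tendsto 0).mono_left (nhdsWithin_le_nhds (s := Ioi (0 : ℝ)))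
      rwa [Real.sqrt_zero, ENNReal.ofReal_zero] at this
    have hlim : Tendsto (fun t : ℝ => ENNReal.ofReal (Real.sqrt t) * ENNReal.ofReal M) (𝓝[>] 0)
        (𝓝 0) := by
      simpa only [zero_mul] using ENNReal.Tendsto.mul_const hsqrt (Or.inr ENNReal.ofReal_ne_top)
    refine tendsto_of_tendsto_of_tendsto_of_le_of_le' tendsto_const_nhds hlim
      (Eventually.of_forall fun _ => zero_le) ?_
    filter_upwards [Ioo_mem_nhdsGT (half_pos hT)] with t ht using hslice t ht

end Identification

/-! ## Step 3: a Besov mild extension is a smooth extension -/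

section Extension

-- `linter.deprecated` is switched off for the next declaration only: its hypothesis `hS` is the
-- deprecated (mis-stated, 2026-08-16) rendering `gkp_smooth_of_isBesovMildSolutionOn` of GKP (1.6),
-- kept verbatim as a record; the corrected form of this step is
-- `hasSmoothExtensionPast_of_isBesovMildSolutionOn_extension_of_bounded` (`NSCriticalClosureBesovBounded.lean`).
set_option linter.deprecated false in
/-- **From a Besov mild extension to a smooth extension** (GKP 2016, (1.6); Beale–Kato–Majda
1984, §1 for the continuation vocabulary). Given the (deprecated, mis-stated — see the module
docstring, §Verdict clean-up; the bounded form of this step, fed by the proved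
`knss_classical_of_bounded_isBesovMildSolutionOn`, is
`hasSmoothExtensionPast_of_isBesovMildSolutionOn_extension_of_bounded`,
`NSCriticalClosureBesovBounded.lean`) fact `gkp_smooth_of_isBesovMildSolutionOn`:
if `(u, p)` is classical on `[0, T)`, `0 < T < T'`, and a Besov mild solution `(v, V)` on
`[0, T')` (class `(-1 + 3/r, r, q)`, `3 < r < ∞`, `1 ≤ q < ∞`) agrees with `u` a.e. at every
time of `[0, T)`, then `u` extends smoothly past `T`: `v` agrees a.e. with a classical `(u', p')`
on `(0, T')`, continuous slices that agree a.e. are equal (Lebesgue measure charges open sets),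
so `u' = u` on `(0, T)`, and `IsClassicalNSSolutionOn.glue` glues `(u, p)` on `[0, T)` to
`(u', p')` on `(0, T')`. [cite: GKP2016, (1.6)] -/
theorem hasSmoothExtensionPast_of_isBesovMildSolutionOn_extension
    (hS : gkp_smooth_of_isBesovMildSolutionOn) {ν T T' : ℝ} (hν : 0 < ν) (hT : 0 < T)
    (hTT' : T < T') {u : ℝ → ℝ³ → ℝ³} {p : ℝ → ℝ³ → ℝ}
    (hsol : FluidPDE.IsClassicalNSSolutionOn (Ico 0 T) ν 0 u p) {r q : ℝ≥0∞} [Fact (1 ≤ r)]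
    (hr₃ : 3 < r) (hr : r < ∞) (hq₁ : 1 ≤ q) (hq : q < ∞) {v : ℝ → ℝ³ → ℝ³}
    {V : ℝ → 𝓢'(ℝ³, ℂ³)} (hv : IsBesovMildSolutionOn (-1 + 3 / r.toReal) r q T' ν v V)
    (hvu : ∀ t ∈ Ico 0 T, v t =ᵐ[volume] u t) : FluidPDE.HasSmoothExtensionPast ν 0 u T := by
  obtain ⟨u', p', hcl, hae⟩ := hS hν (hT.trans hTT') hr₃ hr hq₁ hq hv
  have heq : ∀ t ∈ Ioo 0 T, u t = u' t := fun t ht => by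
    have h1 : u t =ᵐ[volume] u' t :=
      (hvu t ⟨ht.1.le, ht.2⟩).symm.trans (hae t ⟨ht.1, ht.2.trans hTT'⟩)
    exact (Continuous.ae_eq_iff_eq volume (hsol.contDiff_velocity ⟨ht.1.le, ht.2⟩).continuous
      (hcl.contDiff_velocity ⟨ht.1, ht.2.trans hTT'⟩).continuous).1 h1
  refine ⟨T', hTT', _, _, hsol.glue hcl le_rfl hT hTT'.le heq, fun t ht => ?_⟩
  simp only [if_pos ht.2]

end Extension

/-! ## The assembly -/

section Assembly

-- `linter.deprecated` is switched off for the next declaration only: it names the deprecated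
-- (mis-stated) tree-class renderings of GKP Thm. 1 (`gkp_besov_blowup`, `CriticalRegularity.lean`,
-- 2026-08-15) and of GKP (1.6) (`gkp_smooth_of_isBesovMildSolutionOn`, this file, 2026-08-16),
-- kept unchanged for their users; the record below stays a correct implication between them.
set_option linter.deprecated false in
/-- **The critical Besov continuation criterion from GKP's Theorem 1** (Gallagher–Koch–Planchon
2016, Thm. 1, contrapositive, with the identification (1.6); a record over the two deprecated
tree-class renderings `gkp_besov_blowup`, `gkp_smooth_of_isBesovMildSolutionOn` — the criterion
itself is proved unconditionally as `hasSmoothExtensionPast_of_eHomBesovNorm_bounded_holds`,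
`NSCriticalClosureBesovHolds.lean`, and the re-routing of this assembly through the corrected
smoothing statement is `hasSmoothExtensionPast_of_eHomBesovNorm_bounded_of_gkp_knss`,
`NSCriticalClosureBesovBounded.lean`). Given the named facts
`NS.gkp_besov_blowup` (Thm. 1), the Tao 2013 facts `tao2011_hasBoundedSobolevNormsOn`
(Cor. 11.1 + Cor. 4.3 + Thm. 5.4 (iv)), `tao2011_isMildNSSolutionOn_of_memSobolevX` (Cor. 4.3),
`tao2011_smooth_local_existence` (Thm. 5.4 (ii)+(iv)), the Littlewood–Paley facts
`tendsto_lowFreqCutoff_of_memLp_two`, `eHomBesovNorm_le_of_sobolev_one` (BCD) and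
`gkp_smooth_of_isBesovMildSolutionOn` ((1.6)), every classical unforced solution on
`ℝ³ × [0, T)` which is Leray–Hopf from its rapidly decaying datum and whose distributions have
`sup_{0 ≤ t < T} ‖U t‖_{Ḃ^{-1+3/r}_{r,q}} < ∞`, `3 < r, q < ∞`, extends as a classical solution
past `T`. Proof (module docstring): `(u, U)` is a Besov mild solution on `[0, T)`
(`isBesovMildSolutionOn_of_classical`); by Thm. 1 in `sup` form it is not maximal
(`gkp_besov_blowup.not_isMaximalBesovMildSolution_of_biSup_lt_top`), so it has a Besov mild
extension, which is a smooth extension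
(`hasSmoothExtensionPast_of_isBesovMildSolutionOn_extension`). [cite: GKP2016, Thm. 1] -/
theorem hasSmoothExtensionPast_of_eHomBesovNorm_bounded_of_gkp (hG : gkp_besov_blowup)
    (h₁ : tao2011_hasBoundedSobolevNormsOn) (h₂ : tao2011_isMildNSSolutionOn_of_memSobolevX)
    (hTao : tao2011_smooth_local_existence)
    (hR : tendsto_lowFreqCutoff_of_memLp_two) (hE : eHomBesovNorm_le_of_sobolev_one)
    (hS : gkp_smooth_of_isBesovMildSolutionOn) :
    hasSmoothExtensionPast_of_eHomBesovNorm_bounded := by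
  intro ν T hν hT u p U r q _ hr₃ hr hq₃ hq hsol hLH h₀ hU hsup
  have hr₂ : 2 ≤ r := le_trans (by norm_num) hr₃.le
  have hq₂ : 2 ≤ q := le_trans (by norm_num) hq₃.le
  have hq₁ : 1 ≤ q := le_trans (by norm_num) hq₃.le
  -- step 1: `(u, U)` is a Besov mild solution on `[0, T)`
  have hB : IsBesovMildSolutionOn (-1 + 3 / r.toReal) r q T ν u U :=
    isBesovMildSolutionOn_of_classical h₁ h₂ hTao hR hE hν hT hsol hLH h₀ hU hr₂ hr hq₂
  -- step 2: by GKP's Theorem 1 it is not maximal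
  have hnot : ¬ IsMaximalBesovMildSolution (-1 + 3 / r.toReal) r q T ν u U :=
    hG.not_isMaximalBesovMildSolution_of_biSup_lt_top hν hr₃ hr hq₃ hq hT hsup
  -- step 3: a Besov mild extension is a smooth extension
  by_contra hext
  refine hnot ⟨hB, ?_⟩
  rintro ⟨T', hT', v, V, hv, hvu⟩
  exact hext (hasSmoothExtensionPast_of_isBesovMildSolutionOn_extension hS hν hT hT' hsol hr₃ hr
    hq₁ hq hv hvu)

end Assembly

end Literature.Analysis.FluidPDE

end
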